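import Summits.AtomisticToContinuum.FouriersLaw.Theses.EmbeddedDrudeMourre
import Mathlib.MeasureTheory.Integral.IntervalIntegral.Periodic

/-!
# `FGRGap`, line fold-jet-rigidity, stub `stub_oddEssentialGap` — part C: the resolved integrand and the
# rectangle lower bound

Helper file for the crux `Summit.AtomisticToContinuum.FouriersLaw.Theses.EmbeddedDrudeMourre.FGRGap`
(item `stmt-AtomisticToContinuum-12595`), registered stub `stub_oddEssentialGap`.

Given the PARTNER MAP `h` of the resonant set (the conclusion of the structural stub
`stub_branchStructure`: cell-valued, `Ω(k₁,h,k₃) = 0`, doubly `2π`-periodic, off the diagonal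
`resonantSet ω₂ k₁ k₃ = {k₃ mod 2π, h k₁ k₃}`), the resolved energy delta in `boltzmannForm` is ONE term:

* `finsum_resonant_eq_hterm`: for `2π`-periodic `f` and every `(k₁,k₃)`,
  `∑ᶠ_{k₂ resonant} w·(f₁+f₂-f₃-f₄)² = w(k₁,h,k₃)·(f(k₁) + f(h) - f(k₃) - f(k₁+h-k₃))²` — the exchange root
  has vanishing bracket, and so has every root on the diagonal;
* `boltzmannForm_eq_lintegral_hterm`: `q(f) = ¼ ∫⁻_{cell}∫⁻_{cell} ofReal(T_f)`, `T_f` that single term;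
* `collisionWeight` is `2π`-periodic in `k₂` and `k₃`, hence `T_f` is doubly `2π`-periodic;
* `setLIntegral_rect_le` (THE RECTANGLE LOWER BOUND): for every closed rectangle `R = [α,β] × [γ,δ]` with
  sides `< 2π`, `¼ ∫⁻_R ofReal(T_f) d(vol × vol) ≤ q(f)` — shift the cell windows (`AddCircle.lintegral_preimage`,
  periodicity) so that they contain the sides of `R`, and compare the product integral with the iterated one
  (`lintegral_prod_le`, no measurability needed).

Folklore; no named facts.
-/

noncomputable section

open MeasureTheory Set Real Filter Topology
open scoped ENNReal
open Literature.MathematicalPhysics.KineticTheory.PhononBoltzmann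

namespace Summit.AtomisticToContinuum.FouriersLaw.Theorems.FGRGap.FoldJetRigidity.EssGap

/-! ## 1. Periodicity of the collision kernel in `k₃` -/

/-- The vertex is `2π`-periodic in `k₃` (two sine factors change sign). [folklore] -/
theorem vertex_add_two_pi_k3 (a b k₁ k₂ k₃ : ℝ) :
    vertex a b k₁ k₂ (k₃ + 2 * π) = vertex a b k₁ k₂ k₃ := by
  unfold vertex
  have h3 : Real.sin ((k₃ + 2 * π) / 2) = -Real.sin (k₃ / 2) := by
    rw [show (k₃ + 2 * π) / 2 = k₃ / 2 + π by ring, Real.sin_add_pi]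
  have h4 : Real.sin ((k₁ + k₂ - (k₃ + 2 * π)) / 2) = -Real.sin ((k₁ + k₂ - k₃) / 2) := by
    rw [show (k₁ + k₂ - (k₃ + 2 * π)) / 2 = (k₁ + k₂ - k₃) / 2 - π by ring, Real.sin_sub_pi]
  rw [h3, h4]; ring

/-- The collision kernel is `2π`-periodic in `k₃`. [folklore] -/
theorem collisionWeight_add_two_pi_k3 (ω₂ a b k₁ k₂ k₃ : ℝ) :
    collisionWeight ω₂ a b k₁ k₂ (k₃ + 2 * π) = collisionWeight ω₂ a b k₁ k₂ k₃ := by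
  unfold collisionWeight resonanceJacobian
  rw [vertex_add_two_pi_k3, dispersion_periodic ω₂ k₃,
    show k₁ + k₂ - (k₃ + 2 * π) = k₁ + k₂ - k₃ - 2 * π by ring,
    (dispersion_periodic ω₂).sub_eq, (groupVelocity_periodic ω₂).sub_eq]

/-- For a `2π`-periodic `f`, the bracket at the (shifted) exchange root vanishes:
`f k₁ + f (k₃ + 2πn) - f k₃ - f (k₁ + (k₃ + 2πn) - k₃) = 0`. [folklore] -/
theorem bracket_exchange_eq_zero {f : ℝ → ℝ} (hf : Function.Periodic f (2 * π)) (k₁ k₃ : ℝ) (n : ℤ) :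
    f k₁ + f (k₃ + n * (2 * π)) - f k₃ - f (k₁ + (k₃ + n * (2 * π)) - k₃) = 0 := by
  rw [hf.int_mul n k₃, show k₁ + (k₃ + n * (2 * π)) - k₃ = k₁ + n * (2 * π) by ring, hf.int_mul n k₁]
  ring

/-- For a `2π`-periodic `f`, every bracket on the diagonal `k₃ - k₁ ∈ 2πℤ` vanishes. [folklore] -/
theorem bracket_diag_eq_zero {f : ℝ → ℝ} (hf : Function.Periodic f (2 * π)) {k₁ k₃ : ℝ} {n : ℤ}
    (hn : k₃ - k₁ = n * (2 * π)) (k₂ : ℝ) : f k₁ + f k₂ - f k₃ - f (k₁ + k₂ - k₃) = 0 := by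
  have h1 : f k₃ = f k₁ := by rw [show k₃ = k₁ + n * (2 * π) by linarith]; exact hf.int_mul n k₁
  have h2 : f (k₁ + k₂ - k₃) = f k₂ := by
    have e : k₁ + k₂ - k₃ = k₂ + ((-n : ℤ) : ℝ) * (2 * π) := by push_cast; linarith
    rw [e]; exact hf.int_mul (-n) k₂
  rw [h1, h2]; ring

/-! ## 2. The resolved integrand is the single `h`-term -/

/-- `toIocMod` into the cell is a `2πℤ`-shift. [folklore] -/
theorem exists_toIocMod_eq (k : ℝ) : ∃ n : ℤ, toIocMod Real.two_pi_pos (-π) k = k + n * (2 * π) := by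
  refine ⟨-toIocDiv Real.two_pi_pos (-π) k, ?_⟩
  rw [toIocMod, zsmul_eq_mul]
  push_cast
  ring

/-- **The resolved energy delta is one term.** Given a partner map `h` with the two-root property, for
`2π`-periodic `f` and EVERY `(k₁, k₃)`:
`∑ᶠ k₂ ∈ resonantSet ω₂ k₁ k₃, w(k₁,k₂,k₃)(f k₁ + f k₂ - f k₃ - f (k₁+k₂-k₃))² = w(k₁,h,k₃)(…h…)²`.
[folklore] -/
theorem finsum_resonant_eq_hterm {ω₂ : ℝ} {h : ℝ → ℝ → ℝ}
    (hres : ∀ k₁ k₃ : ℝ, resonanceFn ω₂ k₁ (h k₁ k₃) k₃ = 0)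
    (htwo : ∀ k₁ k₃ : ℝ, (∀ n : ℤ, k₃ - k₁ ≠ n * (2 * π)) →
      resonantSet ω₂ k₁ k₃ = {toIocMod Real.two_pi_pos (-π) k₃, h k₁ k₃})
    (a b : ℝ) {f : ℝ → ℝ} (hf : Function.Periodic f (2 * π)) (k₁ k₃ : ℝ) :
    ∑ᶠ k₂ ∈ resonantSet ω₂ k₁ k₃,
        collisionWeight ω₂ a b k₁ k₂ k₃ * (f k₁ + f k₂ - f k₃ - f (k₁ + k₂ - k₃)) ^ 2 =
      collisionWeight ω₂ a b k₁ (h k₁ k₃) k₃ *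
        (f k₁ + f (h k₁ k₃) - f k₃ - f (k₁ + h k₁ k₃ - k₃)) ^ 2 := by
  have _ := hres
  by_cases hdiag : ∃ n : ℤ, k₃ - k₁ = n * (2 * π)
  · obtain ⟨n, hn⟩ := hdiag
    rw [bracket_diag_eq_zero hf hn (h k₁ k₃)]
    simp only [ne_eq, OfNat.ofNat_ne_zero, not_false_eq_true, zero_pow, mul_zero]
    apply finsum_mem_of_eqOn_zero
    intro k₂ _
    simp only [Pi.zero_apply]
    rw [bracket_diag_eq_zero hf hn k₂]
    simp
  · push Not at hdiag
    rw [htwo k₁ k₃ hdiag]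
    obtain ⟨n, hn⟩ := exists_toIocMod_eq k₃
    rw [finsum_mem_insert_zero, finsum_mem_singleton]
    rw [hn, bracket_exchange_eq_zero hf k₁ k₃ n]
    simp

/-- **The form as a double lower integral of the single term.** [folklore] -/
theorem boltzmannForm_eq_lintegral_hterm {ω₂ : ℝ} {h : ℝ → ℝ → ℝ}
    (hres : ∀ k₁ k₃ : ℝ, resonanceFn ω₂ k₁ (h k₁ k₃) k₃ = 0)
    (htwo : ∀ k₁ k₃ : ℝ, (∀ n : ℤ, k₃ - k₁ ≠ n * (2 * π)) →
      resonantSet ω₂ k₁ k₃ = {toIocMod Real.two_pi_pos (-π) k₃, h k₁ k₃})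
    (a b : ℝ) {f : ℝ → ℝ} (hf : Function.Periodic f (2 * π)) :
    boltzmannForm ω₂ a b f = ENNReal.ofReal (1 / 4) *
      ∫⁻ k₁ in Ioc (-π) π, ∫⁻ k₃ in Ioc (-π) π, ENNReal.ofReal
        (collisionWeight ω₂ a b k₁ (h k₁ k₃) k₃ * (f k₁ + f (h k₁ k₃) - f k₃ - f (k₁ + h k₁ k₃ - k₃)) ^ 2) := by
  unfold boltzmannForm
  congr 1
  apply lintegral_congr; intro k₁
  apply lintegral_congr; intro k₃
  rw [finsum_resonant_eq_hterm hres htwo a b hf]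

/-! ## 3. The rectangle lower bound -/

/-- A lower integral of a `2π`-periodic `ℝ≥0∞`-valued function over any window of length `2π` equals the
one over the cell. [folklore] -/
theorem setLIntegral_Ioc_periodic {G : ℝ → ℝ≥0∞} (hG : Function.Periodic G (2 * π)) (t : ℝ) :
    ∫⁻ x in Ioc t (t + 2 * π), G x = ∫⁻ x in Ioc (-π) π, G x := by
  haveI : Fact (0 < 2 * π) := ⟨Real.two_pi_pos⟩
  have h1 := AddCircle.lintegral_preimage (2 * π) t hG.lift
  have h2 := AddCircle.lintegral_preimage (2 * π) (-π) hG.lift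
  simp only [Function.Periodic.lift_coe] at h1 h2
  rw [show -π + 2 * π = π by ring] at h2
  rw [h1, h2]

/-- **Rectangle lower bound.** With the single-term integrand `T_f(k₁,k₃) = w(k₁,h,k₃)·bracket²`
(doubly `2π`-periodic: `h`, `f`, `w` are), for every closed rectangle `[α,β] × [γ,δ]` with sides `< 2π`:
`¼ ∫⁻_{[α,β]×[γ,δ]} ofReal(T_f) d(vol.prod vol) ≤ q(f)`. [folklore] -/
theorem setLIntegral_rect_le {ω₂ : ℝ} {h : ℝ → ℝ → ℝ}
    (hres : ∀ k₁ k₃ : ℝ, resonanceFn ω₂ k₁ (h k₁ k₃) k₃ = 0)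
    (hper : ∀ k₁ k₃ : ℝ, h (k₁ + 2 * π) k₃ = h k₁ k₃ ∧ h k₁ (k₃ + 2 * π) = h k₁ k₃)
    (htwo : ∀ k₁ k₃ : ℝ, (∀ n : ℤ, k₃ - k₁ ≠ n * (2 * π)) →
      resonantSet ω₂ k₁ k₃ = {toIocMod Real.two_pi_pos (-π) k₃, h k₁ k₃})
    (a b : ℝ) {f : ℝ → ℝ} (hf : Function.Periodic f (2 * π)) {α β γ δ : ℝ}
    (hαβ : β - α < 2 * π) (hγδ : δ - γ < 2 * π) :
    ENNReal.ofReal (1 / 4) * ∫⁻ p in Icc α β ×ˢ Icc γ δ, ENNReal.ofReal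
        (collisionWeight ω₂ a b p.1 (h p.1 p.2) p.2 *
          (f p.1 + f (h p.1 p.2) - f p.2 - f (p.1 + h p.1 p.2 - p.2)) ^ 2) ∂(volume.prod volume) ≤
      boltzmannForm ω₂ a b f := by
  set T : ℝ → ℝ → ℝ≥0∞ := fun k₁ k₃ => ENNReal.ofReal (collisionWeight ω₂ a b k₁ (h k₁ k₃) k₃ *
    (f k₁ + f (h k₁ k₃) - f k₃ - f (k₁ + h k₁ k₃ - k₃)) ^ 2) with hT
  -- double periodicity of the integrand
  have hT1 : ∀ k₃, Function.Periodic (fun k₁ => T k₁ k₃) (2 * π) := by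
    intro k₃ k₁
    simp only [hT]
    rw [(hper k₁ k₃).1, collisionWeight_add_two_pi, hf k₁,
      show k₁ + 2 * π + h k₁ k₃ - k₃ = k₁ + h k₁ k₃ - k₃ + 2 * π by ring, hf _]
  have hT3 : ∀ k₁, Function.Periodic (fun k₃ => T k₁ k₃) (2 * π) := by
    intro k₁ k₃
    simp only [hT]
    rw [(hper k₁ k₃).2, collisionWeight_add_two_pi_k3, hf k₃,
      show k₁ + h k₁ k₃ - (k₃ + 2 * π) = k₁ + h k₁ k₃ - k₃ - 2 * π by ring, hf.sub_eq]
  -- windows containing the sides of the rectangle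
  set α' : ℝ := (α + β) / 2 - π with hα'
  set γ' : ℝ := (γ + δ) / 2 - π with hγ'
  have hI : Icc α β ⊆ Ioc α' (α' + 2 * π) := fun x hx => ⟨by rw [hα']; linarith [hx.1], by
    rw [hα']; linarith [hx.2]⟩
  have hJ : Icc γ δ ⊆ Ioc γ' (γ' + 2 * π) := fun x hx => ⟨by rw [hγ']; linarith [hx.1], by
    rw [hγ']; linarith [hx.2]⟩
  rw [boltzmannForm_eq_lintegral_hterm hres htwo a b hf]
  gcongr
  calc ∫⁻ p in Icc α β ×ˢ Icc γ δ, T p.1 p.2 ∂(volume.prod volume)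
      = ∫⁻ p, T p.1 p.2 ∂((volume.restrict (Icc α β)).prod (volume.restrict (Icc γ δ))) := by
        rw [Measure.prod_restrict]
    _ ≤ ∫⁻ k₁ in Icc α β, ∫⁻ k₃ in Icc γ δ, T k₁ k₃ := lintegral_prod_le _
    _ ≤ ∫⁻ k₁ in Ioc α' (α' + 2 * π), ∫⁻ k₃ in Ioc γ' (γ' + 2 * π), T k₁ k₃ := by
        refine (lintegral_mono_set hI).trans (lintegral_mono fun k₁ => lintegral_mono_set hJ)
    _ = ∫⁻ k₁ in Ioc α' (α' + 2 * π), ∫⁻ k₃ in Ioc (-π) π, T k₁ k₃ := by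
        apply lintegral_congr; intro k₁
        exact setLIntegral_Ioc_periodic (hT3 k₁) γ'
    _ = ∫⁻ k₁ in Ioc (-π) π, ∫⁻ k₃ in Ioc (-π) π, T k₁ k₃ := by
        have hP : Function.Periodic (fun k₁ => ∫⁻ k₃ in Ioc (-π) π, T k₁ k₃) (2 * π) := by
          intro k₁
          simp only
          apply lintegral_congr; intro k₃
          exact hT1 k₃ k₁
        exact setLIntegral_Ioc_periodic hP α'

end Summit.AtomisticToContinuum.FouriersLaw.Theorems.FGRGap.FoldJetRigidity.EssGap

namespace Summit.AtomisticToContinuum.FouriersLaw.Theorems.FGRGap.FoldJetRigidity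

/-- REGISTERED HELPER STUB `stub_oddEssentialGap_partC` (landing vehicle of this file): the form
dominates a quarter of the h-branch integrand over any rectangle with sides < 2π (periodic unfolding
of q onto the partner branch). [folklore] -/
theorem stub_oddEssentialGap_partC :
    ∀ (ω₂ : ℝ) (h : ℝ → ℝ → ℝ), (∀ k₁ k₃ : ℝ, resonanceFn ω₂ k₁ (h k₁ k₃) k₃ = 0) →
      (∀ k₁ k₃ : ℝ, h (k₁ + 2 * π) k₃ = h k₁ k₃ ∧ h k₁ (k₃ + 2 * π) = h k₁ k₃) →
      (∀ k₁ k₃ : ℝ, (∀ n : ℤ, k₃ - k₁ ≠ n * (2 * π)) →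
        resonantSet ω₂ k₁ k₃ = {toIocMod Real.two_pi_pos (-π) k₃, h k₁ k₃}) →
      ∀ (a b : ℝ) (f : ℝ → ℝ), Function.Periodic f (2 * π) → ∀ α β γ δ : ℝ, β - α < 2 * π → δ - γ < 2 * π →
        ENNReal.ofReal (1 / 4) * ∫⁻ p in Set.Icc α β ×ˢ Set.Icc γ δ, ENNReal.ofReal
            (collisionWeight ω₂ a b p.1 (h p.1 p.2) p.2 *
              (f p.1 + f (h p.1 p.2) - f p.2 - f (p.1 + h p.1 p.2 - p.2)) ^ 2)
            ∂(MeasureTheory.volume.prod MeasureTheory.volume) ≤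
          boltzmannForm ω₂ a b f :=
  fun _ω₂ _h hres hper htwo a b _f hf _α _β _γ _δ hαβ hγδ =>
    EssGap.setLIntegral_rect_le hres hper htwo a b hf hαβ hγδ

end Summit.AtomisticToContinuum.FouriersLaw.Theorems.FGRGap.FoldJetRigidity

end
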